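import Summits.QuantumFields.YangMills.Theorems.BalabanUVNodesN15VectorPieceEntries
import HarnessLib

/-!
# Route «BalabanUVNodes» (K4 «SpineRates»), node N15 = NE2 — THE ONE-STEP DIFFERENCE OF `∂_νH_k` WITH DECAY: the analytic input of the backward derivative
# pieces' η-rate (Bałaban's (1.63) Hölder sentence, b05's decaying form, read in King's unit-torus currency)

Cell `pub-ymgap`, seat `pub-ymgap-dag-n15-c` (generation g3; R134 ACCELERATION SEAT, strategy s1 «first missing estimate»; HUMAN RULING D-0062; chair R424
venue; `bears_on: R4∕N15`).  Filed `--supports stmt-QuantumFields-19908 --as helper` (K3′; helper).  THEOREMS ONLY; imports BY NAME, nothing in the tree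
modified: n15-a part 15 `…N15VectorPieceEntries` (`reD`, `reD_single`; through it part 12 `…N15DefectKernelVectorPieceDeriv`: `norm_dker_le_tdistT`, part 9
`kingBlockOf_bpt`, part 8 `tdistT_eq_torusSupNorm_rep`), the b05 lineage `B5Hk163TorusHolder` (`dker`, `zlen`, `fdiff_HkOp_apply`) and `B5Hk163TorusHolderDecay`
(`CHD`, `CdecD`, `thetaH`, **`norm_dker_sub_le_decay'`** — the DECAYING Hölder bound of the kernel of the typed `∂_νH_k`), `B5Blocks16.bpt_bijective`,
`B6LowerBound2153Torus` (`toT`, `rep`, `toT_rep`), `King1986.Torus.tdistT`.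

WHY (this seat's `…N15BackwardShift`, the WHY paragraph).  The η-defect of the BACKWARD derived piece `∇⁻_νG = S_{−ν}∂_νG` through King's floor pairing splits as
`S′_{−ν}·𝔇(∂′_νG′, ∂_νG) + 𝔇(S′_{−ν}, S_{−ν})·∂_νG`, and the second term is majorised by the block majorant of the ONE-STEP DIFFERENCE `(1 − S_{−ν})∂_νG =
((1 − S_{−ν})∂_νH_k)·C^{(k)}·(η^{d+1}H_kᵀ)` — a piece-shaped composite whose LEFT FACTOR has the entries `∂_νH_k((x, μ), b) − ∂_νH_k((x − e_κ, μ), b)`: two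
fine points ONE lattice step `η = n⁻¹` apart.  Bałaban's Hölder sentence after (1.63) («bounds on (1∕|x′−x|^α)|∂_ν(H_kB)_μ(x′) − ∂_ν(H_kB)_μ(x)|») makes them
`O(n^{−α})`; b05 typed it WITH DECAY from the nearer endpoint block (`norm_dker_sub_le_decay'`, rate `δ_H(1−α)∕(1+α)`).  THIS FILE reads that theorem at the Hölder
exponent `α = ⅓` — decay rate exactly `δ_H∕2` (the rate every derivative entry of the -a chain already carries) and smallness `n^{−⅓}` — in King's unit-torus
currency `|B(x) − y|_T` (both endpoint blocks displayed; the consumer bounds `min` by `|B(x) − y|_T − 1`, `…N15BackwardShift.tdistT_blockOf_sub_unitVec_le`), and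
in the entry format of n15-a part 26's `hasMaj_plain_unitTorus` for the real linear map `reD`.

CONTENTS.  `toT_single_one` (`(e_κ : ℤ^{d+1}) ↦ e_κ ∈ Π ℤ∕N_μ`), `zlen_single_one` (`‖e_κ‖₂ = 1`), `CHD_third_nonneg`; **`norm_dker_sub_bshift_le`**:
`‖∂_νH_n((x, μ), (y, λ)) − ∂_νH_n((x − e_κ, μ), (y, λ))‖ ≤ CHD(d, ⅓)·(1∕n)^{⅓}·e^{−(δ_H∕2)·min(|B(x) − y|_T, |B(x − e_κ) − y|_T)}`, `δ_H = κ₁₆₃(d+1)∕(d+1)`, uniformly in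
the volume and in `n`; `abs_reD_single_sub_bshift_le` (the same for the entries of the real linear map `reD M n ν`); `abs_reD_single_bshift_le` (the plain
decay of `reD`'s entries read at the stepped-back point, from the block of THAT point — part 12's `norm_dker_le_tdistT`); `exp_neg_min_le` (the slack lemma
`e^{−δ·min(d₁,d₂)} ≤ e^{δt}·e^{−δd₀}` for `d₀ ≤ d_i + t`, by which the consumer passes to the block of `x` alone).

HONEST FRAMING ∕ LIMITS.  One instantiation of a LANDED b05 theorem (no new analytic estimate; constants b05's, dimension-only); `U = 1` linear theory on finite
tori; the exponent `⅓` is a bookkeeping choice (any `α ≤ ⅓` gives decay `≥ δ_H∕2`), NOT printed; nothing with background; NE2⁺ NOT PRINTED ∕ not proved;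
count-neutral (typed 28∕28 · discharged unchanged); NOT a discharge of N15; one finite T⁴ at fixed ε — NOT infinite volume, NOT OS on ℝ⁴, NOT a mass gap, NOT Clay.
-/

noncomputable section

open scoped BigOperators
open Finset Complex

namespace Summit.QuantumFields.YangMills.BalabanUVNodes.N15.DefectKernel

open Literature.MathematicalPhysics.QuantumFieldTheory.Balaban1983to89
open Literature.MathematicalPhysics.QuantumFieldTheory.Balaban1983to89.B4TorusKernel (periodConst)
open Literature.MathematicalPhysics.QuantumFieldTheory.Balaban1983to89.B4TorusKernel.MultiPeriod (torusSupNorm)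
open Literature.MathematicalPhysics.QuantumFieldTheory.Balaban1983to89.B5Prop11Plancherel (Tor fine unitVec)
open Literature.MathematicalPhysics.QuantumFieldTheory.Balaban1983to89.B5Block118 (bpt)
open Literature.MathematicalPhysics.QuantumFieldTheory.Balaban1983to89.B5Blocks16 (bpt_bijective)
open Literature.MathematicalPhysics.QuantumFieldTheory.Balaban1983to89.B5Hk163Strip (kappa163 kappa163_pos)
open Literature.MathematicalPhysics.QuantumFieldTheory.Balaban1983to89.B5Hk163Torus (HkOp)
open Literature.MathematicalPhysics.QuantumFieldTheory.Balaban1983to89.B5Hk163TorusHolder (dker zlen fdiff_HkOp_apply)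
open Literature.MathematicalPhysics.QuantumFieldTheory.Balaban1983to89.B5Hk163TorusHolderDecay (MD163 CHD CdecD thetaH CdecD_nonneg CHolderTorus_nonneg
  thetaH_nonneg thetaH_le_one norm_dker_sub_le_decay')
open Literature.MathematicalPhysics.QuantumFieldTheory.Balaban1983to89.B6LowerBound2153Torus (toT rep toT_rep)
open Literature.MathematicalPhysics.QuantumFieldTheory.King1986.Torus (blockOf tdistT tdistT_nonneg)
open Summit.QuantumFields.YangMills.BalabanUVNodes.N15.VectorPiece (reD reD_single)

variable {d : ℕ}

/-! ## §1 The unit step as an integer displacement -/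

section Step

/-- The integer unit vector `e_κ` descends to the unit lattice vector of every multi-period torus. [folklore] -/
theorem toT_single_one (N : Fin (d + 1) → ℕ) (κ : Fin (d + 1)) : toT N (Pi.single κ (1 : ℤ)) = unitVec N κ := by
  funext i
  by_cases h : i = κ
  · subst h; simp [toT, unitVec]
  · simp [toT, unitVec, h]

/-- `‖e_κ‖₂ = 1`. [folklore] -/
theorem zlen_single_one (κ : Fin (d + 1)) : zlen (Pi.single κ (1 : ℤ)) = 1 := by
  unfold zlen
  rw [Finset.sum_eq_single κ (fun b _ hb => by simp [Pi.single_eq_of_ne hb]) (fun h => absurd (Finset.mem_univ κ) h)]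
  simp

/-- `0 ≤ CHD(d, ⅓)` (b05's decaying-Hölder constant at exponent `⅓`). [folklore] -/
theorem CHD_third_nonneg : 0 ≤ CHD d (1 / 3 : ℝ) := by
  unfold CHD
  exact mul_nonneg (Real.rpow_nonneg (CHolderTorus_nonneg (0 : Fin (d + 1)) (by norm_num) (by norm_num)) _)
    (Real.rpow_nonneg (mul_nonneg zero_le_two (CdecD_nonneg (d := d))) _)

end Step

/-! ## §2 The one-step difference of `∂_νH_k` with decay, in King's unit-torus currency -/

section Kernel

variable (n : ℕ) [NeZero n] (M : Fin (d + 1) → ℕ) [hM : ∀ μ, NeZero (M μ)]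

/-- **THE ONE-STEP DIFFERENCE OF `∂_νH_k` WITH DECAY** (b05 `norm_dker_sub_le_decay'` at Hölder exponent `⅓`, displacement `z = e_κ`, read through
`kingBlockOf_bpt` ∕ `tdistT_eq_torusSupNorm_rep`): for every fine point `x`, unit point `y`, directions `ν, μ, λ` and step direction `κ`,
`‖∂_νH_n((x, μ), (y, λ)) − ∂_νH_n((x − e_κ, μ), (y, λ))‖ ≤ CHD(d, ⅓)·(1∕n)^{⅓}·e^{−(δ_H∕2)·min(|B(x) − y|_T, |B(x − e_κ) − y|_T)}`, `δ_H = κ₁₆₃(d+1)∕(d+1)` —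
Hölder smallness `n^{−⅓}` (one lattice step `η = n⁻¹`) AND exponential decay from the nearer of the two endpoint blocks, uniformly in the volume and in `n`.
[cite: Balaban1984PropagatorsI, (1.63) p.28, p.29 lines 1–2 («This implies bounds on (1∕|x′−x|^α)|∂_ν(H_kB)_μ(x′) − ∂_ν(H_kB)_μ(x)|»)] -/
theorem norm_dker_sub_bshift_le (ν μ lam κ : Fin (d + 1)) (x : Tor (fine n M)) (y : Tor M) :
    ‖(B5Prop11Plancherel.fdiff (fine n M) (n : ℂ) ν * HkOp n M) (x, μ) (y, lam)
        - (B5Prop11Plancherel.fdiff (fine n M) (n : ℂ) ν * HkOp n M) (x - unitVec (fine n M) κ, μ) (y, lam)‖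
      ≤ CHD d (1 / 3 : ℝ) * (1 / (n : ℝ)) ^ (1 / 3 : ℝ) *
          Real.exp (-(kappa163 (d + 1) / (d + 1) / 2 *
            min (tdistT M (blockOf n M x) y) (tdistT M (blockOf n M (x - unitVec (fine n M) κ)) y))) := by
  rw [fdiff_HkOp_apply, fdiff_HkOp_apply]
  -- block coordinates of the two endpoints
  obtain ⟨⟨y₂, a₂⟩, hx₂⟩ := (bpt_bijective n M).2 x
  obtain ⟨⟨y₁, a₁⟩, hx₁⟩ := (bpt_bijective n M).2 (x - unitVec (fine n M) κ)
  simp only at hx₂ hx₁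
  have hB₂ : blockOf n M x = y₂ := by rw [← hx₂, kingBlockOf_bpt]
  have hB₁ : blockOf n M (x - unitVec (fine n M) κ) = y₁ := by rw [← hx₁, kingBlockOf_bpt]
  -- the displacement is the integer unit vector `e_κ`
  have hz : bpt n M (toT M (rep M y₂)) a₂ = bpt n M (toT M (rep M y₁)) a₁ + toT (fine n M) (Pi.single κ (1 : ℤ)) := by
    rw [toT_rep, toT_rep, hx₂, hx₁, toT_single_one, sub_add_cancel]
  have key := norm_dker_sub_le_decay' n M μ lam ν (rep M y₁) (rep M y₂) (rep M y) a₁ a₂ (Pi.single κ (1 : ℤ)) hz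
    (α := 1 / 3) (by norm_num) (by norm_num)
  rw [toT_rep, toT_rep, toT_rep, hx₂, hx₁, zlen_single_one, ← tdistT_eq_torusSupNorm_rep, ← tdistT_eq_torusSupNorm_rep] at key
  rw [show kappa163 (d + 1) / ((d : ℝ) + 1) * ((1 - 1 / 3) / (1 + 1 / 3)) = kappa163 (d + 1) / ((d : ℝ) + 1) / 2 by ring] at key
  rw [hB₂, hB₁]
  exact key

/-- THE SAME FOR THE ENTRIES OF THE REAL LINEAR MAP `reD M n ν` (n15-a part 15: the real parts of the typed `∂_νH_n`'s entries), in the entry format of part 26's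
`hasMaj_plain_unitTorus` (left factor `A = (1 − S_{−κ})∂_νH_n`). [cite: Balaban1984PropagatorsI, (1.63) p.28, p.29 lines 1–2] -/
theorem abs_reD_single_sub_bshift_le (ν κ : Fin (d + 1)) (b : Tor M × Fin (d + 1)) (i : Tor (fine n M) × Fin (d + 1)) :
    |reD M n ν (Pi.single b 1) i - reD M n ν (Pi.single b 1) (i.1 - unitVec (fine n M) κ, i.2)|
      ≤ CHD d (1 / 3 : ℝ) * (1 / (n : ℝ)) ^ (1 / 3 : ℝ) *
          Real.exp (-(kappa163 (d + 1) / (d + 1) / 2 *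
            min (tdistT M (blockOf n M i.1) b.1) (tdistT M (blockOf n M (i.1 - unitVec (fine n M) κ)) b.1))) := by
  rw [reD_single, reD_single, ← Complex.sub_re]
  exact (Complex.abs_re_le_norm _).trans (norm_dker_sub_bshift_le n M ν i.2 b.2 κ i.1 b.1)

/-- THE PLAIN DECAY OF `∂_νH_k` READ AT THE STEPPED-BACK POINT, from the block of that point (part 12 `norm_dker_le_tdistT`, recorded in the shape the backward
pieces' plain majorants consume). [cite: Balaban1984PropagatorsI, (1.63) p.28, p.29 l.1–2 (the derivative kernel; decay method)] -/
theorem abs_reD_single_bshift_le (ν κ : Fin (d + 1)) (b : Tor M × Fin (d + 1)) (i : Tor (fine n M) × Fin (d + 1)) :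
    |reD M n ν (Pi.single b 1) (i.1 - unitVec (fine n M) κ, i.2)| ≤ MD163 (d + 1) * periodConst (kappa163 (d + 1)) d *
      Real.exp (-(kappa163 (d + 1) / (d + 1) * tdistT M (blockOf n M (i.1 - unitVec (fine n M) κ)) b.1)) := by
  rw [reD_single]
  exact (Complex.abs_re_le_norm _).trans (norm_dker_le_tdistT n M ν i.2 b.2 (i.1 - unitVec (fine n M) κ) b.1)

/-- THE DECAY WEAKENED TO THE NEARER-BLOCK FORM WITH A DISPLAYED SLACK: if both endpoint blocks are within unit-torus distance `1` of a reference block `B`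
(`|B − B(x)|_T ≤ 1`-type hypotheses supplied by the consumer from `…N15BackwardShift.tdistT_blockOf_sub_unitVec_le`), then
`e^{−δ·min(|B(x)−y|_T, |B(x−e_κ)−y|_T)} ≤ e^{δt}·e^{−δ|B₀ − y|_T}` whenever both `|B₀ − y|_T ≤ |B(x) − y|_T + t` and `|B₀ − y|_T ≤ |B(x−e_κ) − y|_T + t` (`δ ≥ 0`).
[folklore] -/
theorem exp_neg_min_le {δ t d₀ d₁ d₂ : ℝ} (hδ : 0 ≤ δ) (h₁ : d₀ ≤ d₁ + t) (h₂ : d₀ ≤ d₂ + t) :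
    Real.exp (-(δ * min d₁ d₂)) ≤ Real.exp (δ * t) * Real.exp (-(δ * d₀)) := by
  rw [← Real.exp_add]
  refine Real.exp_le_exp.mpr ?_
  rcases le_total d₁ d₂ with h | h
  · rw [min_eq_left h]; nlinarith
  · rw [min_eq_right h]; nlinarith

end Kernel

end Summit.QuantumFields.YangMills.BalabanUVNodes.N15.DefectKernel

end
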